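import Mathlib

/-!
# SoloBlind kernel #101 — optimal truncation of a Gevrey-`s` series (beyond-all-orders residual)

Solo-blind programme `AnomalousDissipation`, steady door, paper §24.52 (the exponent audit of (H8c)).
The dictionary used there: if the order-`M` residual of the two-scale hierarchy 24.28(6) obeys a
GEVREY-`s` bound `|r M| ≤ C · K^M · (M!)^s · ε^M` for every `M`, then truncating at the optimal order
`M = ⌊(Kε)^{-1/s} / e⌋` leaves a residual that is exponentially small in `(Kε)^{-1/s}`:
`|r M| ≤ C · exp (s - (s/e) · (Kε)^{-1/s})`.  With `ε = n^{-1/9}` and `s = 1/q` this is the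
`exp (-c · n^{q/9})` of §24.52(1): the Gevrey index of the hierarchy, not a constant, decides the
contest with the transient loss `exp (c' · n^{2/9})` measured in §24.52(5) (P80).

Elementary and self-contained: `M! ≤ M^M`, hence `(M!)^s x^M ≤ (M^s x)^M ≤ e^{-sM}` once
`M ≤ x^{-1/s}/e`, and `e^{-sM} ≤ e^{s - (s/e) x^{-1/s}}` because `M > x^{-1/s}/e - 1`.
-/

namespace Summit.AnomalousDissipation.AnomalousDissipation.Theorems

open Real

/-- `M! ≤ M^M` (in `ℝ`). -/
theorem factorial_le_self_pow_real (n : ℕ) : ((n.factorial : ℕ) : ℝ) ≤ (n : ℝ) ^ n := by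
  have h : n.factorial ≤ n ^ n := by
    induction n with
    | zero => simp
    | succ k ih =>
      rw [Nat.factorial_succ, pow_succ']
      calc (k + 1) * k.factorial ≤ (k + 1) * k ^ k := Nat.mul_le_mul_left _ ih
        _ ≤ (k + 1) * (k + 1) ^ k := Nat.mul_le_mul_left _ (Nat.pow_le_pow_left (Nat.le_succ k) k)
  exact_mod_cast h

/-- OPTIMAL TRUNCATION (Gevrey index `s > 0`): for `0 < x` there is an order `M` with
`(M!)^s · x^M ≤ exp (s - (s/e) · x^{-1/s})`.  (Take `M = ⌊x^{-1/s}/e⌋`.) -/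
theorem gevrey_optimal_truncation (s x : ℝ) (hs : 0 < s) (hx : 0 < x) :
    ∃ M : ℕ, (((M.factorial : ℕ) : ℝ)) ^ s * x ^ M ≤ Real.exp (s - s / Real.exp 1 * x ^ (-(1 / s))) := by
  set X : ℝ := x ^ (-(1 / s)) with hXdef
  have hX : 0 < X := Real.rpow_pos_of_pos hx _
  have he : 0 < Real.exp 1 := Real.exp_pos 1
  set M : ℕ := ⌊X / Real.exp 1⌋₊ with hMdef
  have hM_le : (M : ℝ) ≤ X / Real.exp 1 := Nat.floor_le (div_nonneg hX.le he.le)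
  have hM_gt : X / Real.exp 1 < (M : ℝ) + 1 := Nat.lt_floor_add_one _
  refine ⟨M, ?_⟩
  have hM0 : (0 : ℝ) ≤ (M : ℝ) := Nat.cast_nonneg M
  -- step 1: (M!)^s ≤ (M^M)^s = (M^s)^M
  have h1 : (((M.factorial : ℕ) : ℝ)) ^ s ≤ ((M : ℝ) ^ s) ^ M := by
    have hfac : (((M.factorial : ℕ) : ℝ)) ≤ (M : ℝ) ^ M := factorial_le_self_pow_real M
    have hfac0 : (0 : ℝ) ≤ ((M.factorial : ℕ) : ℝ) := Nat.cast_nonneg _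
    calc (((M.factorial : ℕ) : ℝ)) ^ s ≤ ((M : ℝ) ^ M) ^ s := Real.rpow_le_rpow hfac0 hfac hs.le
      _ = ((M : ℝ) ^ s) ^ M := by
          rw [← Real.rpow_natCast (M : ℝ) M, ← Real.rpow_mul hM0, mul_comm, Real.rpow_mul hM0,
            Real.rpow_natCast]
  -- step 2: M^s * x ≤ exp (-s)
  have h2 : (M : ℝ) ^ s * x ≤ Real.exp (-s) := by
    have hMs : (M : ℝ) ^ s ≤ (X / Real.exp 1) ^ s := Real.rpow_le_rpow hM0 hM_le hs.le
    have hXs : X ^ s = x⁻¹ := by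
      rw [hXdef, ← Real.rpow_mul hx.le]
      have : -(1 / s) * s = -1 := by field_simp
      rw [this, Real.rpow_neg_one]
    have hes : (Real.exp 1) ^ s = Real.exp s := by
      rw [← Real.exp_one_rpow s]
    have hq : (X / Real.exp 1) ^ s = x⁻¹ / Real.exp s := by
      rw [Real.div_rpow hX.le he.le, hXs, hes]
    calc (M : ℝ) ^ s * x ≤ (X / Real.exp 1) ^ s * x := mul_le_mul_of_nonneg_right hMs hx.le
      _ = x⁻¹ / Real.exp s * x := by rw [hq]
      _ = Real.exp (-s) := by rw [Real.exp_neg]; field_simp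
  -- step 3: ((M^s) ^ M) * x^M = (M^s * x)^M ≤ exp(-s)^M = exp (-s*M)
  have h3 : ((M : ℝ) ^ s) ^ M * x ^ M ≤ Real.exp (-s * M) := by
    rw [← mul_pow]
    have h0 : (0 : ℝ) ≤ (M : ℝ) ^ s * x := mul_nonneg (Real.rpow_nonneg hM0 s) hx.le
    calc ((M : ℝ) ^ s * x) ^ M ≤ (Real.exp (-s)) ^ M := pow_le_pow_left₀ h0 h2 M
      _ = Real.exp (-s * M) := by rw [← Real.exp_nat_mul]; ring_nf
  -- step 4: exp (-s*M) ≤ exp (s - s/e * X)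
  have h4 : Real.exp (-s * M) ≤ Real.exp (s - s / Real.exp 1 * X) := by
    rw [Real.exp_le_exp]
    have : s / Real.exp 1 * X = s * (X / Real.exp 1) := by ring
    rw [this]
    nlinarith [hM_gt, hs]
  calc (((M.factorial : ℕ) : ℝ)) ^ s * x ^ M ≤ ((M : ℝ) ^ s) ^ M * x ^ M :=
        mul_le_mul_of_nonneg_right h1 (pow_nonneg hx.le M)
    _ ≤ Real.exp (-s * M) := h3
    _ ≤ Real.exp (s - s / Real.exp 1 * X) := h4

/-- THE DICTIONARY (§24.52(1)): a Gevrey-`s` residual bound `|r M| ≤ C K^M (M!)^s ε^M` at every order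
leaves, at the optimal order, a residual `≤ C · exp (s - (s/e) (Kε)^{-1/s})` — beyond all orders in `ε`,
with the exponent `(Kε)^{-1/s}` (for `ε = n^{-1/9}`, `s = 1/q`: `∝ n^{q/9}`). -/
theorem residual_beyond_all_orders (r : ℕ → ℝ) (C K ε s : ℝ) (hC : 0 ≤ C) (hK : 0 < K) (hε : 0 < ε)
    (hs : 0 < s) (hr : ∀ M : ℕ, |r M| ≤ C * K ^ M * (((M.factorial : ℕ) : ℝ)) ^ s * ε ^ M) :
    ∃ M : ℕ, |r M| ≤ C * Real.exp (s - s / Real.exp 1 * (K * ε) ^ (-(1 / s))) := by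
  obtain ⟨M, hM⟩ := gevrey_optimal_truncation s (K * ε) hs (mul_pos hK hε)
  refine ⟨M, (hr M).trans ?_⟩
  have : C * K ^ M * (((M.factorial : ℕ) : ℝ)) ^ s * ε ^ M
      = C * ((((M.factorial : ℕ) : ℝ)) ^ s * (K * ε) ^ M) := by rw [mul_pow]; ring
  rw [this]
  exact mul_le_mul_of_nonneg_left hM hC

/-- THE CONTEST OF EXPONENTS (§24.52(6)): a beyond-all-orders residual `exp (-F · n^p)` beats a
transient loss `exp (L · n^γ)` squared (the Newton criterion `e^{2L n^γ} · e^{-F n^p} < 1`) for all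
large `n` as soon as `p > γ` — whatever the constants `F, L > 0`.  Stated on the exponents. -/
theorem exponent_contest (F L p γ : ℝ) (hF : 0 < F) (hL : 0 < L) (hpγ : γ < p) :
    ∃ n₀ : ℝ, 0 < n₀ ∧ ∀ n : ℝ, n₀ ≤ n → 2 * L * n ^ γ < F * n ^ p := by
  -- n^p = n^γ · n^(p-γ) and n^(p-γ) > 2L/F once n > (2L/F)^{1/(p-γ)}
  have hd : 0 < p - γ := sub_pos.mpr hpγ
  set A : ℝ := 2 * L / F with hA
  have hApos : 0 < A := by rw [hA]; positivity
  refine ⟨A ^ (1 / (p - γ)) + 1, by positivity, fun n hn => ?_⟩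
  have hn0 : 0 < n := by
    have : 0 < A ^ (1 / (p - γ)) := Real.rpow_pos_of_pos hApos _
    linarith
  have hAn : A < n ^ (p - γ) := by
    have h1 : A ^ (1 / (p - γ)) < n := by linarith
    have h2 : (A ^ (1 / (p - γ))) ^ (p - γ) < n ^ (p - γ) :=
      Real.rpow_lt_rpow (Real.rpow_nonneg hApos.le _) h1 hd
    rwa [← Real.rpow_mul hApos.le, one_div_mul_cancel hd.ne', Real.rpow_one] at h2
  have hsplit : n ^ p = n ^ γ * n ^ (p - γ) := by
    rw [← Real.rpow_add hn0]; ring_nf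
  rw [hsplit]
  have hγpos : 0 < n ^ γ := Real.rpow_pos_of_pos hn0 γ
  have : 2 * L = F * A := by rw [hA]; field_simp
  rw [this]
  have h3 : A * n ^ γ < n ^ γ * n ^ (p - γ) := by
    rw [mul_comm A]; exact mul_lt_mul_of_pos_left hAn hγpos
  calc F * A * n ^ γ = F * (A * n ^ γ) := by ring
    _ < F * (n ^ γ * n ^ (p - γ)) := mul_lt_mul_of_pos_left h3 hF

end Summit.AnomalousDissipation.AnomalousDissipation.Theorems
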